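import Mathlib
import HarnessLib
import HarnessLib.Audit
import Summits.AtomisticToContinuum.Statement
import HarnessLib.Audit.Status.Attr

/-!
Route: AnosovRotorDice

CLOSED (retired) 2026-08-15T13:38:27Z by operator:999:1257524 — reason: not-a-thesis: assembly does not conclude the sub-problem Statement — note: D-0027 §2.1 audit (human 2026-08-15: routes that do not decide the summit are removed): the assembly concludes `Literature.MathematicalPhysics.KineticTheory.HydrodynamicLimit`, not the sub-problem statement; a NEW conforming route may be opened from the same idea (generated `closes : … → _root_.Hydr. The file is kept as the record of this route; refuted decls are indexed as negative knowledge (`ledger negatives`).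

# Route AnosovRotorDice — Deterministic dice — OVY's noise step (B) from a one-sphere Hopf property,
theorem-sized for Anosov-rotor spheres, conjecture for specular spheres

It suffices to show X = X_B ∧ X_OVY. X_B (STEP (B) WITHOUT NOISE): at small reduced density every
regular (translation-invariant, finite density / energy / specific entropy) stationary state of the
infinite hard-sphere dynamics that arises in Yau's one-block step has, conditionally on the
positions, momenta distributed as a mixture of independent Maxwellians with common drift and
temperature — the ONLY step of OllaVaradhanYau1993 that uses the noise (§4 (B); (C)–(E) are
deterministic). The route obtains X_B as OneSphereHopfToMaxwellian (rank 2: a measure-rigidity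
MACHINE — absolute continuity of each sphere's next scattering outcome given everything else forces
Maxwellian momenta) applied to SpecularDiceHopf (rank 3: the true gas has that one-sphere Hopf
property along collision-wavefront unstable curves). X_OVY: the deterministic remainder of OVY for
hard spheres (steps (C)–(E), Gronwall, large deviations, virial EOS, cubic tails =
EnergyCurrentTails rank 6) giving the typed target RelEntropyVanishing (shared stmt-0766), with the
finite-N typed waypoint MaxwellianOneBody (rank 5: one-body local-Maxwellian LLN, the observable
content of X_B). Card realised: anosov-rotor-spheres — its deterministic rotor gas HS_rot(Ω, F)
(hard spheres whose outgoing directions are steered, flux-preservingly, by internal Anosov rotors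
θ_i ∈ T¹M read at each contact; fixed density, true kinetic energy, the conjunct's EOS and Euler
system, reversible, randomness only in the data) is the CALIBRATION RUNG where the machine's
hypothesis is theorem-sized: RotorDiceHopf (rank 4), whence the first deterministic positive-density
Euler theorem (support RotorGasEulerLimit). MODEL (fixes the flux flaw found at triage): between
contacts x_i is ballistic and θ_i follows the geodesic flow g_(Ωt) of a closed hyperbolic surface
(Liouville measure m, involution ι); at a contact with normal ω and incoming relative velocity g the
pair keeps its centre-of-mass velocity and |g| and leaves with g′ = |g|·Λ_ω⁻¹(F(θ_i,θ_j)(Λ_ω(S_ω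
g/|g|))), S_ω specular, Λ_ω Lambert's projection of the outgoing hemisphere onto the unit disc of
ω^⊥ (flux measure ↦ area), F(θ,θ′) an area-preserving disc diffeomorphism (time-one map of a
compactly supported disc Hamiltonian with smooth (θ,θ′)-dependent coefficients, frame-free); hence
Liouville ⊗ m^⊗ and every Gibbs ⊗ m^⊗ state are invariant, pair momentum/energy are exact, and for
F(ιθ,ιθ′) conjugate-inverse to F(θ,θ′) the flow is reversible under (v,θ) ↦ (−v,ιθ). F ≡ id is the
conjunct's gas.
Lean: `Summit.AtomisticToContinuum.HydrodynamicLimit.Theses.RelEntropyErgodic.RelEntropyVanishing`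

## Assembly
The typed chain is the shared one: RelEntropyVanishing → HydrodynamicLimit by the entropy inequality
(item 0769, shared with RelEntropyErgodic / ChaoticMixing / VanishingNoise / KineticWindows; pure
measure theory over Mathlib's klDiv). Upstream of the target the composition is informal until the
definition requests land: SpecularDiceHopf → OneSphereHopfToMaxwellian ⇒ X_B (step (B) for the true
gas) ⇒ with OVY §4 (C)–(E), RelEntropyGronwall (0780), EnergyCurrentTails (rank 6) /
KineticFluxClosure, VirialEosIdentification (0782) and LocalGibbsConcentration (0767) ⇒
RelEntropyVanishing; the typed waypoint MaxwellianOneBody sits between X_B and the target (X_B ⇒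
MaxwellianOneBody by OVY compactness; RelEntropyVanishing ⇒ MaxwellianOneBody by
MaxwellianOfEntropy). The calibration rung RotorDiceHopf → OneSphereHopfToMaxwellian ⇒
RotorGasEulerLimit is a parallel chain for HS_rot and is NOT a hypothesis of the conjunct's assembly
(stated as such; it is where the machine is first provable).

Rationale: WHY THIS LINE. OllaVaradhanYau1993 (§1 p. 525, §4) and FritzFunakiLebowitz1994 / LiveraniOlla1996
use conservative noise for one thing: the Dirichlet form of the noise vanishes on a regular
stationary state, so its conditional velocity law is invariant under pair re-scattering, hence
Maxwellian (step (B)); the barrier files BoltzmannHypothesisBarrierNarrow / MacroErgodicityBarrier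
record that nothing replaces this for deterministic dynamics. The card's move is to replace the
Dirichlet form by a HOPF ARGUMENT: if each sphere's scattering outcome is read off a coordinate
along which the state is absolutely continuous (an unstable plaque), invariance spreads that
absolute continuity over the pair shells and the same exchangeability conclusion follows — smooth
ergodic theory (Hopf/Anosov–Sinai absolute continuity, u-Gibbs rigidity LedrappierYoung1985,
accessibility BrinPesin1974 / BurnsWilkinson2010, Anosov-fibre limit theorems Dolgopyat2005,
DolgopyatLiverani2011, DesimoiLiverani2018, CanestrariLiveraniOlla2026) imported into Yau's
relative-entropy architecture at HYPERBOLIC scaling with collisional O(1) coupling, where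
CanestrariLiveraniOlla2026 is diffusive and weakly coupled. Putting the uniform hyperbolicity INSIDE
each molecule (HS_rot) makes every estimate a one-sphere-against-frozen-environment estimate with no
N-dependence, so the machine can first be certified on a genuine deterministic reversible
fixed-density gas, and the residual conjecture for the true gas is localised sharply: "specular
collision sequences of one tagged sphere are as good a die as an Anosov rotor" (SpecularDiceHopf) —
this is what the line does that RelEntropyErgodic's bare GibbsErgodicity (stmt-0779, all-informal,
parked by refuters) and ChaoticMixing's n-uniform box mixing do not. Two typed finite-N waypoints
(MaxwellianOneBody new; EnergyCurrentTails shared with KineticWindows) make step (B) and its tail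
input refutable now; negatives index empty at filing.

RANKED CRUXES. Three cruxes and two supports need vocabulary Lean lacks (regular stationary states
of the infinite-volume dynamics, the diced flow, the die interface: definition requests D1–D3); they
are filed right after open with `ledger workitem add --informal` and typed by set-signature when the
definitions land. In rank order:
Rank 2, OneSphereHopfToMaxwellian (informal) — THE MACHINE (replaces the Dirichlet-form step of
FritzFunakiLebowitz1994 / LiveraniOlla1996 = OVY §4 (B)): for the infinite-volume diced hard-sphere
dynamics at reduced density < η₀ with ANY die (K, m, g, ι, F) of interface D1, INCLUDING F ≡ id (the
conjunct's gas), let μ be a translation-invariant stationary state with finite density and energy,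
finite specific entropy relative to Gibbs ⊗ m^⊗, under which a.s. every sphere collides infinitely
often. ONE-SPHERE HOPF PROPERTY (H): for μ-a.e. configuration and every sphere i the conditional law
of the outgoing relative direction of i's NEXT collision, given the present state of all other
spheres and i's own position and speed data, is absolutely continuous w.r.t. the flux measure of the
outgoing hemisphere. CLAIM: (H) ⇒ conditionally on all positions (and rotor states) the velocities
are a mixture of independent Maxwellians with common (u, β) — step (B) — hence, by OVY §4 (C)–(E)
run for hard cores, μ is a mixture of Gibbs states ⊗ m^⊗. Why it might fail: a.c. of ONE outcome is
much weaker than invariance under the pair re-scattering group; the upgrade needs an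
entropy-monotone iteration along each sphere's collision sequence with partners chosen by the
dynamics, and stationarity + finite entropy may not forbid velocity–position correlations carried by
WHICH pairs collide (partner selection; card angles-are-not-enough-partner-selection). Sources:
OllaVaradhanYau1993 §4 (B)–(E), FritzFunakiLebowitz1994 §1.1, LiveraniOlla1996, Bernardin2014 §1.1
Def. 1, BurnsWilkinson2010.
Rank 3, SpecularDiceHopf (informal) — SPECULAR REFLECTION IS AS GOOD A DIE (residual conjecture for
the TRUE gas, F ≡ id): at reduced density < η₀ every regular translation-invariant stationary state
of the infinite hard-sphere dynamics arising as a limit point of OVY's space-time-averaged laws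
(smooth local Gibbs data, hyperbolic scaling, pre-shock) has property (H), the absolute continuity
being read along the COLLISION-WAVEFRONT unstable curves of the tagged sphere (the convex front of
post-collisional directions created by dispersing at its previous collision, expansion ≍ free flight
/ diameter). Why it might fail: the Boltzmann-hypothesis input localised to one sphere — the
unstable curves are made by the N-body collision geometry with unbounded distortion at grazing /
near-simultaneous collisions, and u-regularity along them must survive OVY's weak limit (cards
pesin-defect-u-gibbs-rigidity U1/U2, pesin-defect-prices-u-regularity); nothing beyond finite-N
qualitative ergodicity (Simanyi2013) exists. Sources: Simanyi2013, SimanyiSzasz1999,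
ChernovDolgopyat2009, OllaVaradhanYau1993 §1 p. 525,
Literature.Barriers.AtomisticToContinuum.BoltzmannHypothesisBarrierNarrow.
Rank 4, RotorDiceHopf (informal) — THE CALIBRATION THEOREM (card crux 1): for every closed
hyperbolic surface M, rotor speed Ω > 0 and die F satisfying D1 there is η₀(Ω,F) > 0 such that at
reduced density < η₀ every regular translation-invariant stationary state of infinite-volume
HS_rot(Ω,F) arising as an OVY limit point from local Gibbs ⊗ m^⊗ data is ROTOR-u-REGULAR —
conditional measures along finite products of rotor-unstable (horocycle) plaques, everything else
frozen, are absolutely continuous — hence has property (H) by push-forward through the pair-plaque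
submersion (θ_i,θ_j) ↦ F(θ_i,θ_j)(p) (the rotor marginal is exactly m^⊗: finite specific entropy
makes finite-window rotor marginals a.c., and the autonomous product geodesic flow is ergodic). Why
it might fail: (i) rotor-unstable directions are unstable for the COUPLED skew product only where Ω
dominates the gas's local backward expansion, unbounded on collision clusters in infinite volume
(non-uniform domination; measure estimates for collision-sequence changes under holonomy); (ii)
u-regularity must pass to OVY's weak limits, where leafwise entropy is only upper semicontinuous and
no Ledrappier–Young identity is available for an infinite-volume singular skew product. Sources:
LedrappierYoung1985, BrinPesin1974, BurnsWilkinson2010, Dolgopyat2005, DolgopyatLiverani2011,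
DesimoiLiverani2018, CanestrariLiveraniOlla2026, Liverani2004.
Support RotorGasEulerLimit (informal) — THE ANALOGUE THEOREM (card crux 2; the first deterministic,
reversible, positive-density compressible-Euler theorem if completed): given cruxes 2 and 4, for
every (M, Ω, F) and continuous profiles ∃ σ₀ ∀ σ < σ₀, pre-shock, the analogue of
RelEntropyVanishing with HardSphereFlow replaced by the HS_rot flow on Config × K^(N+1) (D2) and
localGibbsLaw by localGibbsLaw ⊗ m^⊗(N+1) — same IsHardSphereEulerSolution and hsPressure, the die
does not touch the statics — by OVY's proof run for a collisional dynamics (one-block from cruxes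
2+4 and OVY (C)–(E); LD from LocalGibbsConcentration 0767; EOS from VirialEosIdentification 0782;
contact currents; tails = EnergyCurrentTails for the diced flow). Sources: OllaVaradhanYau1993,
Yau1991, FritzFunakiLebowitz1994.
Support DiceConstruction (informal, typable over Mathlib after D1) — the CONSTRUCTION kept out of
the interface: (a) a smooth family F : T¹M × T¹M → (area-preserving diffeomorphisms of the closed
unit disc compactly supported in the open disc) exists with full support, pair-plaque submersivity
off a null set and the reversibility symmetry F(ιθ,ιθ′) = C∘F(θ,θ′)⁻¹∘C (time-one maps of disc
Hamiltonians a(θ,θ′)φ(|p|²) + (b(θ,θ′)·p)ψ(|p|²), frame-free); (b) the geodesic flow of a closed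
hyperbolic surface is a contact Anosov flow with smooth horocycle foliation, Liouville-ergodic,
exponentially mixing — an instance of D1. Sources: Liverani2004, Dolgopyat2005, BrinPesin1974,
FeresZhang2012.
#0 RelEntropyVanishing (target) — Yau's entropy form of the limit — shared typed target (stmt-0766)
of RelEntropyErgodic / ChaoticMixing / VanishingNoise / KineticWindows: pre-shock, ∀ t < T an
activity profile a_t whose local Gibbs law concentrates the three fields exponentially around
(ρ,ρu,E)(t) and klDiv(law_t ‖ localGibbs(a_t,u_t,θ_t))/(N+1) → 0. (why it might fail: in substance
the conjunct: deterministic spheres at fixed σ may not keep local equilibrium on Euler times; known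
only with noise (OllaVaradhanYau1993 Thm 2.1) and, via MaxwellianOfEntropy, refuted by any
refutation of MaxwellianOneBody.) [Yau1991, OllaVaradhanYau1993, Spohn1991]
#5 MaxwellianOneBody (crux) — ONE-BODY LOCAL-MAXWELLIAN LAW OF LARGE NUMBERS (new typed waypoint;
the observable finite-N content of step (B)): same quantifier frame as HydrodynamicLimit; for every
t < T, bounded continuous ψ on 𝕋³ × ℝ³ and δ > 0, P_N(|∫ψ d(empirical measure of Φ_N,t z) −
∫ρ_t(x)∫ψ(x,v) M_(1,u_t(x),θ_t(x))(v) dv dx| > δ) → 0 under the initial local Gibbs law. Delivered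
by X_B through OVY's compactness; necessary for the target (MaxwellianOfEntropy); not implied by
HydrodynamicLimit (velocity SHAPE, not five moments); false for free flight. [difficulty:
open-problem] (why it might fail: It is propagation of local equilibrium for the one-body law: false
for free flight (velocity sorting transports f₀(x−vt,v), not a local Maxwellian) and for d=1 rods;
at fixed σ no deterministic mechanism is proved (OVY1993 §1 p525); a persistent anisotropic fast
component kills it.) [OllaVaradhanYau1993 §1 p. 525 and §4 (B), Spohn1991 Part I §2.4 p. 25 and Ch.
3, Literature.Barriers.AtomisticToContinuum.BoltzmannHypothesisBarrierNarrow,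
FritzFunakiLebowitz1994 §1.1]
#6 EnergyCurrentTails (crux) — UNIFORM INTEGRABILITY OF THE CUBIC VELOCITY TAILS PRE-SHOCK, shared
verbatim with KineticWindows (stmt-3655; the consumable form of 0781): ∀ t < T ∀ ε > 0 ∃ M, N₀ ∀ N ≥
N₀ ∀ s ∈ [0,t]: E[(N+1)⁻¹Σ_i |v_i(s)|³ 1(|v_i(s)| > M)] ≤ ε along the evolution. Tail input of BOTH
OVY chains here (true gas and HS_rot — the card's crux 2 fails 'only through tails'); with
MaxwellianOneBody it gives the kinetic flux closure. [difficulty: open-problem] (why it might fail: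
Energy conservation bounds only quadratic moments and entropy w.r.t. Gibbs sees nothing above |v|²;
the deterministic dynamics could focus energy ≍N^(2/3) on O(1) spheres with non-negligible
probability — no maximum principle for hard-sphere energy cascades is known (HighMomentumCutoff).)
[NachtergaeleYau2003 §2.3 Assumption II.1, OllaVaradhanYau1993 §1 p. 525,
Literature.Barriers.AtomisticToContinuum.HighMomentumCutoffBarrierNarrow, Spohn1991 Part I Ch. 3]
#9 KineticFluxClosure (support) — KINETIC FLUX CLOSURE (the flux-level form Yau's one-block step
consumes for the kinetic currents, cf. BoltzmannHypothesisBarrierNarrow kernel (5)): for every t <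
T, continuous χ, δ > 0, i, j: empirical kinetic stress N⁻¹Σχ(x_k)v_k^i v_k^j and kinetic energy
current N⁻¹Σχ(x_k)|v_k|²v_k^i/2 at time t are within δ, with probability → 1, of ∫χ(ρu^iu^j +
ρθδ_ij) and ∫χρ(|u|²/2 + 5θ/2)u^i. Consequence node (KineticFluxOfTails); the collisional part of
the stress is VirialEosIdentification (0782), not re-filed. [difficulty: open-problem]
[OllaVaradhanYau1993 §3 p. 537,
Literature.Barriers.AtomisticToContinuum.BoltzmannHypothesisBarrierNarrow, Spohn1991 Part I Ch. 3
(3.6)–(3.8)]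
#9 KineticFluxOfTails (support) — glue, provable now: truncate v⊗v and v|v|²/2 by a continuous
cutoff at speed M (bounded continuous test function: MaxwellianOneBody); remainder ≤
‖χ‖_∞M⁻¹(N+1)⁻¹Σ|v_k|³1(|v_k|>M), small in mean (EnergyCurrentTails) hence in probability; Gaussian
truncation error uniform since θ_t, u_t are continuous on the compact torus. [difficulty:
provable-now] [OllaVaradhanYau1993 §3, KipnisLandim1999 Ch. 6]
#9 MaxwellianOfEntropy (support) — the waypoint is NECESSARY for the target, provable now: entropy
inequality μ(A) ≤ (log 2 + H(μ|λ))/log(1 + 1/λ(A)) as in 0769, plus an exponential LLN for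
N⁻¹Σψ(x_k,v_k) under the reference local Gibbs law (velocities conditionally independent Maxwellians
given positions — product form of canonicalDensity ∘ localGibbsProfile — so Hoeffding around
N⁻¹Σg(x_k), g = ∫ψ M dv continuous, then the density-field clause with χ = g). A refutation of
MaxwellianOneBody refutes the shared target of five routes mechanically. [difficulty: M] [Yau1991,
OllaVaradhanYau1993 §3 Lemma 3.7, KipnisLandim1999 Ch. 6]

TWO-LAYER PLAN. Foreseen glued splits (nothing filed now): (a) MaxwellianOneBody ⇐
StepBCompactnessTransfer: "X_B for OVY limit states ⇒ the finite-N one-body LLN" (OVY §4 (A),(E):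
limit points of space-time averaged local laws are regular stationary states; glue
OneSphereHopfToMaxwellian → SpecularDiceHopf → StepBCompactnessTransfer → MaxwellianOneBody once D3
lands). (b) RotorDiceHopf ⇐ RotorDomination → RotorURegularityLimit → RotorDiceHopf: RotorDomination
= strong-unstable leaves of the coupled skew product (rotors = Anosov base, gas = fibre) are Hölder
graphs over the pair plaques W^u(θ_i) × W^u(θ_j) off a set of small measure with tempered distortion
(rotor rate Ω vs the gas's local backward expansion); RotorURegularityLimit = rotor-u-regularity of
local Gibbs ⊗ m^⊗ data propagates along the HS_rot evolution and to OVY's space-time-averaged weak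
limits. (c) OneSphereHopfToMaxwellian ⇐ HopfToShellInvariance (a.c. outgoing conditionals +
stationarity ⇒ conditional velocity law invariant under the pair re-scattering group, by iteration
along collision sequences with an entropy monotonicity) → ShellInvarianceToMaxwellian
(FritzFunakiLebowitz1994 / OVY exchangeability: re-scattering-invariant + translation-invariant
regular ⇒ Maxwellian mixture; essentially known) → OneSphereHopfToMaxwellian.

KILL CRITERIA. (1) A regular translation-invariant stationary state of some diced hard-sphere gas
(any smooth full-support flux-preserving F, or F ≡ id) that HAS the one-sphere Hopf property but
non-Maxwellian conditional momenta refutes OneSphereHopfToMaxwellian and closes the route outright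
(close --reason refuted:OneSphereHopfToMaxwellian); it would also retire every "dice" card on file.
(2) ¬MaxwellianOneBody (typed) closes the route and, through MaxwellianOfEntropy, refutes the shared
target RelEntropyVanishing (routes RelEntropyErgodic, ChaoticMixing, VanishingNoise, KineticWindows
lose their target; the conjunct survives only via non-entropy routes). (3) ¬RotorDiceHopf — an
HS_rot(Ω,F) with smooth full-support F admitting an anisotropic regular stationary state, or a proof
that rotor-u-regularity is destroyed in OVY's weak limit — kills the calibration claim; pivot =
close unless SpecularDiceHopf has independent support (it would not: the true gas is strictly
harder). (4) ¬EnergyCurrentTails closes every entropy route including this one (shared kill with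
KineticWindows). Mooted, not killed: GibbsErgodicity (0779) proved directly supersedes cruxes 2–3
(close --reason superseded --by route-AtomisticToContinuum-RelEntropyErgodic);
FixedFractionCumulantExpansion (0804) proved implies MaxwellianOneBody.

NOT DECOMPOSED YET. The infinite-volume objects (definition request D3: marked locally finite
configurations, Alexander's a.s. dynamics, regular stationary states, specific entropy), the diced
flow (D2) and the die interface with its separate construction statement (D1) — cruxes 2–4 stay
informal until they land and are then typed by set-signature; OVY's deterministic steps (C)–(E) for
hard cores (stationary + Maxwellian-given-positions ⇒ Gibbs, a Gurevich–Suhov-type hierarchy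
argument with contact terms) kept inside crux 2's statement; the Gronwall / LD / virial chain =
items 0780, 0767, 0782 of RelEntropyErgodic, attached informally, not re-filed; the Ω- and
F-dependence of the density threshold η₀(Ω,F); grazing and collision-sequence-change measure
estimates for the holonomies; the choice of a_t by the inverse EOS (HsEosLowDensity 0768).

CHEAPEST FALSIFIER. (i) Two-rotor READABILITY ALGEBRA, finite-dimensional, doable by hand/CAS: for a
concrete F (two compactly supported disc Hamiltonians with coefficients f(θ_i), f(θ_j)) check that
(θ,θ′) ↦ F(θ,θ′)(p) restricted to E^u(θ) ⊕ E^u(θ′) is a submersion onto the disc off a null set, and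
that iterating collisions of one tagged sphere against a FROZEN Poisson environment spreads absolute
continuity from the disc to its full velocity law (transitivity of the generated re-scattering moves
on pair shells); if no smooth F does this, RotorDiceHopf and the machine die cheaply. (ii) Numerics
(kit; not run by this planner): event-driven MD of HS_rot with a cat-map rotor surrogate at packing
0.05 — kinetic-stress isotropisation and tagged-velocity decorrelation vs Ω; none at fixed Ω
falsifies the premise. (iii) Lookup: non-ergodic compact-group extensions of Anosov systems
(coboundary cocycles; Brin's genericity) warn that a degenerate F can hide invariants — excluded by
the full-support / pair-plaque-submersion clauses of D1, to be checked by the refuter on the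
concrete F of (i).

NUMBERS. Fixed reduced density (N+1)ε³ = σ³; ≍ (N+1)^(1/3) collisions per sphere per macroscopic
unit time (HardSphereEuler.lean docstring). In microscopic units (diameter 1, thermal speed 1) the
mean free path is ℓ ≈ 1/(√2·π·σ³) (≈ 4.5 at σ³ = 0.05, ≈ 22.5 at σ³ = 0.01) and the true gas's
per-collision expansion factor is ≍ ℓ, i.e. a Lyapunov RATE ≍ log ℓ / ℓ ≈ 0.33 (σ³ = 0.05), 0.14 (σ³
= 0.01) — so a rotor of curvature −1 run at any fixed speed Ω ≳ 1 dominates the TYPICAL gas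
instability at small σ, and domination can fail only on collision clusters (RotorDomination). dim
T¹M = 3 with 1-dimensional horocycle (strong-unstable) leaves: one rotor reads a CURVE in the
2-disc, two rotors (the colliding pair) read an open set — hence the pair plaques in crux 4. OVY's
noise: intensity θ(ε) → ∞ with εθ(ε) → 0 (OllaVaradhanYau1993 §2.1 p. 527); here no parameter is
sent anywhere: Ω is fixed.

DEFINITION REQUESTS. D1 `AnosovDie` (topic Summits/AtomisticToContinuum/HydrodynamicLimit/Theorems;
INTERFACE only, existence is the separate support DiceConstruction): compact metric K, Borel
probability m, measurable m-preserving flow g, involution ι reversing g, local unstable plaques with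
a.c. holonomy-invariant disintegration of m, exponential mixing for Hölder observables; die map F :
K × K → (closed unit disc → itself), jointly smooth, area-preserving, compactly supported in the
open disc, FULL SUPPORT (law of F(θ,θ′)(p) under m⊗m equivalent to Lebesgue, p in the open disc),
PAIR-PLAQUE SUBMERSIVITY off a null set, reversibility symmetry. D2 `DicedHardSphereFlow` (same
topic): IsDicedHardSphereTrajectory / flow structure on Config N d X × (Fin N → K) mirroring
Literature.Analysis.FluidPDE.IsHardSphereTrajectory / HardSphereFlow with the rule g′ = |g|Λ_ω⁻¹
F(θ_i,θ_j) Λ_ω S_ω (g/|g|), rotors flowing by g_(Ωt) between contacts, preserving liouville ⊗ m^⊗;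
torus existence (Alexander) as a separate statement. D3 `RegularStationaryState` (topic
Literature/MathematicalPhysics/KineticTheory): translation-invariant probability measures on locally
finite (marked) hard-sphere configurations of ℝ³ × ℝ³ (× K), invariance under Alexander's a.s.
infinite-volume dynamics, finite density / energy, specific relative entropy w.r.t. Gibbs (⊗ m^⊗) —
common need of GibbsErgodicity (0779) and cruxes 2–4.

Novelty: Searches (2026-08-15): lit frontier AtomisticToContinuum --since 2020 (30 rows: the only
deterministic hydrodynamic-type limit is CanestrariLiveraniOlla2026 = arXiv:2310.13338, diffusive,
weak coupling); lit bridges AtomisticToContinuum --cross any (30 rows, none on internal-state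
gases); lit search --source crossref ×3 — "random billiards microstructure … Feres" (8 hits:
doi:10.1017/cbo9780511755187.008, FeresZhang2012 = doi:10.1007/s00220-012-1469-0,
doi:10.3934/dcds.2016065, doi:10.1088/0951-7715/25/9/2503), "u-Gibbs partially hyperbolic skew
product Anosov base a.c. invariant measure rigidity" (8 generic acim hits + Pesin–Sinai
doi:10.1007/978-0-387-87870-6_13), "De Simoi Liverani fast–slow" (DesimoiLiverani2018 =
doi:10.1007/s00222-018-0798-9, doi:10.1007/s00222-016-0651-y, doi:10.1007/s10955-016-1628-3);
OpenAlex / Semantic Scholar / arXiv cascades returned HTTP 429 (daily budget), lit search --hybrid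
(local searchd) reset the connection, lit galaxy search --star all / --star pdf queued > 90 s twice
(saturated) — logged in NOTES.md, not retried in a loop; the card's two refuter audits
(novelty-audit-3-0, triage-4-0) had already searched crossref/frontier and their prior-art list is
adopted: Dolgopyat2005, DolgopyatLiverani2011, De Simoi–Liverani, Melbourne–Stuart 2011,
Gottwald–Melbourne 2013, Kelly–Melbourne 2016/17 (hyperbolic clocks driving slow variables),
Feres–Zhang / Chumley–Cook–Feres / Eckmann–Young rotating scatterers (scattering laws from
deterministic micros  [refs: 10.1017/cbo9780511755187.008, 10.1007/s00220-012-1469-0, 10.3934/dcds.2016065, 10.1088/0951-7715/25/9/2503, 10.1007/978-0-387-87870-6_13, 10.1007/s00222-018-0798-9, 10.1007/s00222-016-0651-y, 10.1007/s10955-016-1628-3, 2310.13338, doi:10.1017/cbo9780511755187.008, doi:10.1007/s00220-012-1469-0, doi:10.3934/dcds.2016065, doi:10.1088/0951-7715/25/9/2503, doi:10.1007/978-0-387-87870-6_13, doi:10.1007]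

Barriers (technique_class: hopf-argument anosov-fibre u-gibbs-rigidity relative-entropy): - technique_class: hopf-argument anosov-fibre u-gibbs-rigidity relative-entropy
- Literature.Barriers.AtomisticToContinuum.BoltzmannHypothesisBarrier: MET HEAD-ON, which its scope
caveat (b) allows ("a proof of the needed input evades the barrier"): cruxes 2–3 ARE a proposed
proof of the classification input for the true gas and crux 4 proves it for HS_rot; the formal
kernel (ideal gas: every velocity law h is stationary) is respected because the machine's hypothesis
requires μ-a.s. infinitely many collisions per sphere and reads absolute continuity only through
collisions — with no collisions the die is never read and nothing is claimed.
- Literature.Barriers.AtomisticToContinuum.BoltzmannHypothesisBarrierNarrow: the narrowed,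
flux-level statement is exactly what the typed items track: KineticFluxClosure is the kinetic part
of the one-block closure (its kernel (5), a rest-frame heat current of the free gas, is what
MaxwellianOneBody + EnergyCurrentTails exclude for the interacting gas); the barrier blocks closures
obtained VIA the classification without a proof — this route supplies the proof attempt, it does not
assume the classification.
- Literature.Barriers.AtomisticToContinuum.MacroErgodicityBarrier: its evasion (a) "add conservative
noise" is replaced by "read a deterministic Anosov die at each contact"; Euler scaling, so no sector
condition / fluctuation–dissipation step is needed; for the true gas it is not evaded but attacked
(crux 3), honestly labelled conjunct-har

History (route lifecycle, newest last):
- 2026-08-15T13:38:27Z · CLOSED retired — not-a-thesis: assembly does not conclude the sub-problem Statement (operator:999:1257524)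

sub-problem: HydrodynamicLimit · status: closed(retired) · opened planner-plancard-AtomisticToContinuum-Hydrody-7cf9054b-0 2026-08-15T11:34:57Z · rev 0 · ledger route-AtomisticToContinuum-AnosovRotorDice
GENERATED by the gate from the ledger (D-0016/17). Provers cite these decls: `theorem foo : Summit.AtomisticToContinuum.HydrodynamicLimit.Theses.AnosovRotorDice.<Decl> := …` in Summits/AtomisticToContinuum/HydrodynamicLimit/Theorems/<Name>.lean.
-/

namespace Summit.AtomisticToContinuum.HydrodynamicLimit.Theses.AnosovRotorDice

open scoped BigOperators Topology Manifold Classical MeasureTheory ProbabilityTheory Matrix InnerProductSpace ComplexConjugate ContinuousMap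
open Filter Set Function TopologicalSpace MeasureTheory

attribute [summit_statement] _root_.HydrodynamicLimit

/-- item stmt-AtomisticToContinuum-0766 · target · rank 0 · open · by planner
why it might fail: in substance the conjunct: deterministic spheres at fixed σ may not keep local equilibrium on Euler times; known only with noise (OllaVaradhanYau1993 Thm 2.1) and, via MaxwellianOfEntropy, refuted by any refutation of MaxwellianOneBody.
sources: Yau1991, OllaVaradhanYau1993, Spohn1991
[target] X_RE: for all continuous profiles ∃ σ₀ ∀ σ<σ₀ ∀ classical hs-Euler solutions on [0,T) ∀
flows: the initial local Gibbs laws are probability measures and, if their fields converge at t=0,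
then ∀ t<T ∃ activity profile a_t such that the reference local Gibbs law (a_t, u_t, θ_t) is a
probability measure whose empirical density/momentum/energy fields concentrate exponentially (≤ C
e^{-(N+1)/C}) around (ρ,ρu,E)(t), and klDiv(lawAt Φ_N (localGibbs a₀u₀θ₀) t ‖ localGibbs a_t u_t
θ_t)/(N+1) → 0. Yau1991; OllaVaradhanYau1993 Thm 1.1 (with noise). -/
@[route_item "route-AtomisticToContinuum-AnosovRotorDice"]
def RelEntropyVanishing : Prop :=
  ∀ (a₀ θ₀ : Literature.MathematicalPhysics.KineticTheory.T3 → ℝ) (u₀ : Literature.MathematicalPhysics.KineticTheory.T3 → Literature.MathematicalPhysics.KineticTheory.V3), Continuous a₀ → Continuous θ₀ → Continuous u₀ → (∀ x, 0 < a₀ x) → (∀ x, 0 < θ₀ x) → ∃ σ₀ : ℝ, 0 < σ₀ ∧ ∀ σ : ℝ, 0 < σ → σ < σ₀ → ∀ (T : ℝ) (ρ θ : ℝ → Literature.MathematicalPhysics.KineticTheory.T3 → ℝ) (u : ℝ → Literature.MathematicalPhysics.KineticTheory.T3 → Literature.MathematicalPhysics.KineticTheory.V3), Literature.MathematicalPhysics.KineticTheory.IsHardSphereEulerSolution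 σ T ρ u θ → ∀ Φ : (N : ℕ) → Literature.Analysis.FluidPDE.HardSphereFlow (Literature.Analysis.FluidPDE.Torus.geometry (Fin 3)) (Literature.MathematicalPhysics.KineticTheory.hsDiameter σ N) (N + 1), (∀ N, MeasureTheory.IsProbabilityMeasure (Literature.MathematicalPhysics.KineticTheory.localGibbsLaw σ a₀ u₀ θ₀ N (Φ N))) ∧ (Literature.MathematicalPhysics.KineticTheory.TendstoHydroFieldsAt (fun N => Literature.MathematicalPhysics.KineticTheory.localGibbsLaw σ a₀ u₀ θ₀ N (Φ N)) Φ ρ u θ 0 → ∀ t ∈ Set.Ico 0 T, ∃ a : Literature.MathematicalPhysics.KineticTheory.T3 → ℝ, (∀ N, MeasureTheory.IsProbabilityMeasure (Literature.MathematicalPhysics.KineticTheory.localGibbsLaw σ a (u t) (θ t) N (Φ N))) ∧ (∀ χ : Literature.MathematicalPhysics.KineticTheory.T3 → ℝ, Continuous χ → ∀ δ : ℝ, 0 < δ → ∃ C : ℝ, 0 < C ∧ ∀ N : ℕ, Literature.MathematicalPhysics.KineticTheory.localGibbsLaw σ a (u t) (θ t) N (Φ N) {z | δ < |Literature.MathematicalPhysics.KineticTheory.empiricalDensityField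 z χ - ∫ x, χ x * ρ t x|} ≤ ENNReal.ofReal (C * Real.exp (-(C⁻¹ * (N + 1)))) ∧ Literature.MathematicalPhysics.KineticTheory.localGibbsLaw σ a (u t) (θ t) N (Φ N) {z | δ < ‖Literature.MathematicalPhysics.KineticTheory.empiricalMomentumField z χ - ∫ x, (χ x * ρ t x) • u t x‖} ≤ ENNReal.ofReal (C * Real.exp (-(C⁻¹ * (N + 1)))) ∧ Literature.MathematicalPhysics.KineticTheory.localGibbsLaw σ a (u t) (θ t) N (Φ N) {z | δ < |Literature.MathematicalPhysics.KineticTheory.empiricalEnergyField z χ - ∫ x, χ x * Literature.MathematicalPhysics.KineticTheory.totalEnergyDensity (ρ t x) (u t x) (θ t x)|} ≤ ENNReal.ofReal (C * Real.exp (-(C⁻¹ * (N + 1))))) ∧ Filter.Tendsto (fun N : ℕ => InformationTheory.klDiv ((Φ N).lawAt (Literature.MathematicalPhysics.KineticTheory.localGibbsLaw σ a₀ u₀ θ₀ N (Φ N)) t) (Literature.MathematicalPhysics.KineticTheory.localGibbsLaw σ a (u t) (θ t) N (Φ N)) / ((N : ENNReal) + 1)) Filter.atTop (nhds 0))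

-- item stmt-AtomisticToContinuum-5118 · crux · rank 2 · closed · moot by None · by planner — informal only, no Lean statement yet:
--   [crux] THE MACHINE — ONE-SPHERE HOPF PROPERTY FORCES MAXWELLIAN MOMENTA (replaces the Dirichlet-form
--   step of FritzFunakiLebowitz1994 / LiveraniOlla1996 = OllaVaradhanYau1993 §4 step (B); needs
--   definitions AnosovDie (D1), DicedHardSphereFlow (D2), RegularStationaryState (D3)). Setting: the
--   infinite-volume diced hard-sphere dynamics in ℝ³ at reduced density < η₀ with ANY die (K, m, g, ι,
--   F) of interface D1 — between contacts spheres fly ballistically and rotors θ_i ∈ K follow g_(Ωt); at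
--   a contact with normal ω and incoming relative velocity g the pair keeps its centre-of-mass velocity
--   and |g| an

-- item stmt-AtomisticToContinuum-5155 · crux · rank 3 · closed · moot by None · by planner — informal only, no Lean statement yet:
--   [crux] SPECULAR REFLECTION IS AS GOOD A DIE AS AN ANOSOV ROTOR — the residual conjecture for the
--   TRUE hard-sphere gas (trivial die F ≡ id; needs definition RegularStationaryState (D3)). At reduced
--   density < η₀: every translation-invariant stationary state of the infinite-volume hard-sphere
--   dynamics in ℝ³ with finite density, energy and specific entropy relative to Gibbs that ARISES AS A
--   LIMIT POINT of OVY's space-time-averaged local laws (smooth local Gibbs data, hyperbolic scaling,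
--   pre-shock times; OllaVaradhanYau1993 §4 steps (A),(E)) has the one-sphere Hopf property (H) of crux
--   OneSphereHop

-- item stmt-AtomisticToContinuum-5239 · crux · rank 4 · closed · moot by None · by planner — informal only, no Lean statement yet:
--   [crux] THE CALIBRATION THEOREM — ANOSOV-ROTOR SPHERES HAVE THE ONE-SPHERE HOPF PROPERTY (card
--   anosov-rotor-spheres crux 1, steps (A)–(C); needs definitions AnosovDie (D1), DicedHardSphereFlow
--   (D2), RegularStationaryState (D3)). For every closed hyperbolic surface M (rotor space K = T¹M,
--   Liouville measure m, geodesic flow g, flip involution ι), every rotor speed Ω > 0 and every die map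
--   F : K × K → (area-preserving diffeomorphisms of the closed unit disc, compactly supported in the
--   open disc) satisfying the D1 clauses (joint smoothness; FULL SUPPORT: for p in the open disc the law
--   of F(θ,θ′)(p)

/-- item stmt-AtomisticToContinuum-4742 · crux · rank 5 · closed · moot by None · by planner
why it might fail: It is propagation of local equilibrium for the one-body law: false for free flight (velocity sorting transports f₀(x−vt,v), not a local Maxwellian) and for d=1 rods; at fixed σ no deterministic mechanism is proved (OVY1993 §1 p525); a persistent anisotropic fast component kills it.
sources: OllaVaradhanYau1993 §1 p. 525 and §4 (B), Spohn1991 Part I §2.4 p. 25 and Ch. 3, Literature.Barriers.AtomisticToContinuum.BoltzmannHypothesisBarrierNarrow, FritzFunakiLebowitz1994 §1.1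
[crux] ONE-BODY LOCAL-MAXWELLIAN LAW OF LARGE NUMBERS (new typed waypoint; the observable finite-N
content of step (B)): same quantifier frame as HydrodynamicLimit; for every t < T, bounded
continuous ψ on 𝕋³ × ℝ³ and δ > 0, P_N(|∫ψ d(empirical measure of Φ_N,t z) − ∫ρ_t(x)∫ψ(x,v)
M_(1,u_t(x),θ_t(x))(v) dv dx| > δ) → 0 under the initial local Gibbs law. Delivered by X_B through
OVY's compactness; necessary for the target (MaxwellianOfEntropy); not implied by HydrodynamicLimit
(velocity SHAPE, not five moments); false for free flight. [difficulty: open-problem] -/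
@[route_item "route-AtomisticToContinuum-AnosovRotorDice", crux]
def MaxwellianOneBody : Prop :=
  ∀ (a₀ θ₀ : Literature.MathematicalPhysics.KineticTheory.T3 → ℝ) (u₀ : Literature.MathematicalPhysics.KineticTheory.T3 → Literature.MathematicalPhysics.KineticTheory.V3), Continuous a₀ → Continuous θ₀ → Continuous u₀ → (∀ x, 0 < a₀ x) → (∀ x, 0 < θ₀ x) → ∃ σ₀ : ℝ, 0 < σ₀ ∧ ∀ σ : ℝ, 0 < σ → σ < σ₀ → ∀ (T : ℝ) (ρ θ : ℝ → Literature.MathematicalPhysics.KineticTheory.T3 → ℝ) (u : ℝ → Literature.MathematicalPhysics.KineticTheory.T3 → Literature.MathematicalPhysics.KineticTheory.V3), Literature.MathematicalPhysics.KineticTheory.IsHardSphereEulerSolution σ T ρ u θ → ∀ Φ : (N : ℕ) → Literature.Analysis.FluidPDE.HardSphereFlow (Literature.Analysis.FluidPDE.Torus.geometry (Fin 3)) (Literature.MathematicalPhysics.KineticTheory.hsDiameter σ N) (N + 1), Literature.MathematicalPhysics.KineticTheory.TendstoHydroFieldsAt (fun N => Literature.MathematicalPhysics.KineticTheory.localGibbsLaw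 σ a₀ u₀ θ₀ N (Φ N)) Φ ρ u θ 0 → ∀ t ∈ Set.Ico 0 T, ∀ ψ : Literature.MathematicalPhysics.KineticTheory.T3 × Literature.MathematicalPhysics.KineticTheory.V3 → ℝ, Continuous ψ → (∃ B : ℝ, ∀ y, |ψ y| ≤ B) → ∀ δ : ℝ, 0 < δ → Filter.Tendsto (fun N : ℕ => Literature.MathematicalPhysics.KineticTheory.localGibbsLaw σ a₀ u₀ θ₀ N (Φ N) {z | δ < |∫ y, ψ y ∂(Literature.Analysis.FluidPDE.empiricalMeasure ((Φ N).flow t z)) - ∫ x, ρ t x * ∫ v, ψ (x, v) * Literature.Analysis.FluidPDE.localMaxwellian 1 (θ t x) (u t x) v|}) Filter.atTop (nhds 0)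

/-- item stmt-AtomisticToContinuum-3655 · crux · rank 6 · closed · moot by None · by planner
why it might fail: Energy conservation bounds only quadratic moments and entropy w.r.t. Gibbs sees nothing above |v|²; the deterministic dynamics could focus energy ≍N^(2/3) on O(1) spheres with non-negligible probability — no maximum principle for hard-sphere energy cascades is known (HighMomentumCutoff).
sources: NachtergaeleYau2003 §2.3 Assumption II.1, OllaVaradhanYau1993 §1 p. 525, Literature.Barriers.AtomisticToContinuum.HighMomentumCutoffBarrierNarrow, Spohn1991 Part I Ch. 3
[crux] UNIFORM INTEGRABILITY OF THE ENERGY-CURRENT TAILS BEFORE THE FIRST SHOCK (card crux 3's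
irreducible tail input; the consumable, corrected form of RelEntropyErgodic's LargeVelocityControl
0781, whose exponential-cubic-moment wording is false already at t = 0). For continuous profiles ∃
σ₀ ∀ σ ∈ (0,σ₀) ∀ classical hs-Euler solutions (ρ,u,θ) on [0,T) ∀ flow families Φ_N: if the local
Gibbs fields converge at t = 0 to (ρ,ρu,E)(0), then ∀ t < T ∀ ε > 0 ∃ M ∃ N₀ ∀ N ≥ N₀ ∀ s ∈ [0,t]:
E_{λ^N}[(N+1)⁻¹ Σ_i |v_i(s)|³ 1{|v_i(s)| > M}] ≤ ε, v_i(s) the velocities of (Φ_N.flow s z). On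
pre-shock horizons it follows from the catalogued open hypothesis
Literature.Barriers.AtomisticToContinuum.HighMomentumCutoff σ (Nachtergaele–Yau II.1 transcribed),
which is NOT assumed here (the item is weaker: cubic uniform integrability in mean, pre-shock only,
σ₀ profile-dependent). [difficulty: open-problem] -/
@[route_item "route-AtomisticToContinuum-AnosovRotorDice"]
def EnergyCurrentTails : Prop :=
  ∀ (a₀ θ₀ : Literature.MathematicalPhysics.KineticTheory.T3 → ℝ) (u₀ : Literature.MathematicalPhysics.KineticTheory.T3 → Literature.MathematicalPhysics.KineticTheory.V3), Continuous a₀ → Continuous θ₀ → Continuous u₀ → (∀ x, 0 < a₀ x) → (∀ x, 0 < θ₀ x) → ∃ σ₀ : ℝ, 0 < σ₀ ∧ ∀ σ : ℝ, 0 < σ → σ < σ₀ → ∀ (T : ℝ) (ρ θ : ℝ → Literature.MathematicalPhysics.KineticTheory.T3 → ℝ) (u : ℝ → Literature.MathematicalPhysics.KineticTheory.T3 → Literature.MathematicalPhysics.KineticTheory.V3), Literature.MathematicalPhysics.KineticTheory.IsHardSphereEulerSolution σ T ρ u θ → ∀ Φ : (N : ℕ) → Literature.Analysis.FluidPDE.HardSphereFlow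 (Literature.Analysis.FluidPDE.Torus.geometry (Fin 3)) (Literature.MathematicalPhysics.KineticTheory.hsDiameter σ N) (N + 1), Literature.MathematicalPhysics.KineticTheory.TendstoHydroFieldsAt (fun N => Literature.MathematicalPhysics.KineticTheory.localGibbsLaw σ a₀ u₀ θ₀ N (Φ N)) Φ ρ u θ 0 → ∀ t ∈ Set.Ico 0 T, ∀ ε : ℝ, 0 < ε → ∃ M : ℝ, ∃ N₀ : ℕ, ∀ N : ℕ, N₀ ≤ N → ∀ s ∈ Set.Icc 0 t, ∫⁻ z, ENNReal.ofReal (((N : ℝ) + 1)⁻¹ * ∑ i : Fin (N + 1), Set.indicator {v : Literature.MathematicalPhysics.KineticTheory.V3 | M < ‖v‖} (fun v => ‖v‖ ^ 3) (((Φ N).flow s z i).2)) ∂(Literature.MathematicalPhysics.KineticTheory.localGibbsLaw σ a₀ u₀ θ₀ N (Φ N)) ≤ ENNReal.ofReal ε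

/-- item stmt-AtomisticToContinuum-4743 · support · rank 9 · closed · moot by None · by planner
sources: OllaVaradhanYau1993 §3 p. 537, Literature.Barriers.AtomisticToContinuum.BoltzmannHypothesisBarrierNarrow, Spohn1991 Part I Ch. 3 (3.6)–(3.8)
[support] KINETIC FLUX CLOSURE (the flux-level form Yau's one-block step consumes for the kinetic
currents, cf. BoltzmannHypothesisBarrierNarrow kernel (5)): for every t < T, continuous χ, δ > 0, i,
j: empirical kinetic stress N⁻¹Σχ(x_k)v_k^i v_k^j and kinetic energy current N⁻¹Σχ(x_k)|v_k|²v_k^i/2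
at time t are within δ, with probability → 1, of ∫χ(ρu^iu^j + ρθδ_ij) and ∫χρ(|u|²/2 + 5θ/2)u^i.
Consequence node (KineticFluxOfTails); the collisional part of the stress is VirialEosIdentification
(0782), not re-filed. [difficulty: open-problem] -/
@[route_item "route-AtomisticToContinuum-AnosovRotorDice"]
def KineticFluxClosure : Prop :=
  ∀ (a₀ θ₀ : Literature.MathematicalPhysics.KineticTheory.T3 → ℝ) (u₀ : Literature.MathematicalPhysics.KineticTheory.T3 → Literature.MathematicalPhysics.KineticTheory.V3), Continuous a₀ → Continuous θ₀ → Continuous u₀ → (∀ x, 0 < a₀ x) → (∀ x, 0 < θ₀ x) → ∃ σ₀ : ℝ, 0 < σ₀ ∧ ∀ σ : ℝ, 0 < σ → σ < σ₀ → ∀ (T : ℝ) (ρ θ : ℝ → Literature.MathematicalPhysics.KineticTheory.T3 → ℝ) (u : ℝ → Literature.MathematicalPhysics.KineticTheory.T3 → Literature.MathematicalPhysics.KineticTheory.V3), Literature.MathematicalPhysics.KineticTheory.IsHardSphereEulerSolution σ T ρ u θ → ∀ Φ : (N : ℕ) → Literature.Analysis.FluidPDE.HardSphereFlow (Literature.Analysis.FluidPDE.Torus.geometry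 (Fin 3)) (Literature.MathematicalPhysics.KineticTheory.hsDiameter σ N) (N + 1), Literature.MathematicalPhysics.KineticTheory.TendstoHydroFieldsAt (fun N => Literature.MathematicalPhysics.KineticTheory.localGibbsLaw σ a₀ u₀ θ₀ N (Φ N)) Φ ρ u θ 0 → ∀ t ∈ Set.Ico 0 T, ∀ χ : Literature.MathematicalPhysics.KineticTheory.T3 → ℝ, Continuous χ → ∀ δ : ℝ, 0 < δ → ∀ i j : Fin 3, Filter.Tendsto (fun N : ℕ => Literature.MathematicalPhysics.KineticTheory.localGibbsLaw σ a₀ u₀ θ₀ N (Φ N) {z | δ < |∫ y, χ y.1 * (y.2 i * y.2 j) ∂(Literature.Analysis.FluidPDE.empiricalMeasure ((Φ N).flow t z)) - ∫ x, χ x * (ρ t x * (u t x i * u t x j) + (if i = j then ρ t x * θ t x else 0))|}) Filter.atTop (nhds 0) ∧ Filter.Tendsto (fun N : ℕ => Literature.MathematicalPhysics.KineticTheory.localGibbsLaw σ a₀ u₀ θ₀ N (Φ N) {z | δ < |∫ y, χ y.1 * (‖y.2‖ ^ 2 / 2 * y.2 i) ∂(Literature.Analysis.FluidPDE.empiricalMeasure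 ((Φ N).flow t z)) - ∫ x, χ x * (ρ t x * (‖u t x‖ ^ 2 / 2 + 5 / 2 * θ t x) * u t x i)|}) Filter.atTop (nhds 0)

/-- item stmt-AtomisticToContinuum-4744 · support · rank 9 · closed · moot by None · by planner
sources: OllaVaradhanYau1993 §3, KipnisLandim1999 Ch. 6
[support] glue, provable now: truncate v⊗v and v|v|²/2 by a continuous cutoff at speed M (bounded
continuous test function: MaxwellianOneBody); remainder ≤ ‖χ‖_∞M⁻¹(N+1)⁻¹Σ|v_k|³1(|v_k|>M), small in
mean (EnergyCurrentTails) hence in probability; Gaussian truncation error uniform since θ_t, u_t are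
continuous on the compact torus. [difficulty: provable-now] -/
@[route_item "route-AtomisticToContinuum-AnosovRotorDice"]
def KineticFluxOfTails : Prop :=
  MaxwellianOneBody → EnergyCurrentTails → KineticFluxClosure

/-- item stmt-AtomisticToContinuum-4745 · support · rank 9 · closed · moot by None · by planner
sources: Yau1991, OllaVaradhanYau1993 §3 Lemma 3.7, KipnisLandim1999 Ch. 6
[support] the waypoint is NECESSARY for the target, provable now: entropy inequality μ(A) ≤ (log 2 +
H(μ|λ))/log(1 + 1/λ(A)) as in 0769, plus an exponential LLN for N⁻¹Σψ(x_k,v_k) under the reference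
local Gibbs law (velocities conditionally independent Maxwellians given positions — product form of
canonicalDensity ∘ localGibbsProfile — so Hoeffding around N⁻¹Σg(x_k), g = ∫ψ M dv continuous, then
the density-field clause with χ = g). A refutation of MaxwellianOneBody refutes the shared target of
five routes mechanically. [difficulty: M] -/
@[route_item "route-AtomisticToContinuum-AnosovRotorDice"]
def MaxwellianOfEntropy : Prop :=
  RelEntropyVanishing → MaxwellianOneBody

-- item stmt-AtomisticToContinuum-5314 · support · rank 9 · closed · moot by None · by planner — informal only, no Lean statement yet:
--   [support] THE ANALOGUE THEOREM — FIXED-DENSITY COMPRESSIBLE EULER FROM THE DETERMINISTIC ROTOR GAS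
--   (card anosov-rotor-spheres crux 2; typable once DicedHardSphereFlow (D2) lands; if completed, the
--   first deterministic, time-reversible, Liouville-preserving, positive-density compressible-Euler
--   theorem — the hyperbolic-scale, collisional-coupling counterpart of CanestrariLiveraniOlla2026's
--   diffusive Anosov-fibre heat equation). GIVEN cruxes OneSphereHopfToMaxwellian (5118) and
--   RotorDiceHopf (5239): for every closed hyperbolic surface M, rotor speed Ω > 0 and die F with the D1
--   clauses, and all con

-- item stmt-AtomisticToContinuum-5377 · support · rank 9 · closed · moot by None · by planner — informal only, no Lean statement yet:
--   [support] THE CONSTRUCTION STATEMENT FOR THE DIE (existence kept OUT of the interface AnosovDie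
--   (D1), per the planner rule "never smuggle existence into the interface"; (a) is typable over Mathlib
--   now modulo bookkeeping, (b) after D1). (a) DISC DICE EXIST: let M be a closed hyperbolic surface, K
--   = T¹M with Liouville probability m, geodesic flow g, flip ι(x,ξ) = (x,−ξ), and E^u ⊂ TK the (smooth,
--   1-dimensional) unstable = expanding-horocycle line field. There is a jointly C^∞ family F : K × K →
--   Diff_area(D̄) of area-preserving diffeomorphisms of the closed unit disc D̄ ⊂ ℝ², each equal to the
--   id

/-- item stmt-AtomisticToContinuum-0769 · assembly · rank 1 · open · by planner
sources: Yau1991, OllaVaradhanYau1993, KipnisLandim1999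
[assembly] X_RE → HydrodynamicLimit: entropy inequality μ(A) ≤ (log 2 + H(μ|λ))/log(1 + 1/λ(A))
(from Donsker–Varadhan / Mathlib klDiv API) with λ(A) ≤ C e^{-(N+1)/C} and H = o(N) gives μ(A) → 0;
μ = lawAt (Φ N) P t = P.map (flow t) turns μ{z | δ < |field z − ·|} into P{z | δ < |field (flow t z)
− ·|} (measurable_flow); the reference concentration is stated for z itself and TendstoHydroFieldsAt
at time 0 of the reference law is not needed. Zero-mass case impossible by the IsProbabilityMeasure
clauses; take σ₀ from X_RE. -/
@[route_item "route-AtomisticToContinuum-AnosovRotorDice"]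
def Assembly : Prop :=
  RelEntropyVanishing → Literature.MathematicalPhysics.KineticTheory.HydrodynamicLimit

end Summit.AtomisticToContinuum.HydrodynamicLimit.Theses.AnosovRotorDice
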